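import Literature.AlgebraicGeometry.Motives.HodgeThetaSubalgebraUnitaryRankOneRaise
import Literature.AlgebraicGeometry.Motives.HodgeThetaSubalgebraUnitaryLeviFull
import HarnessLib

/-!
# A rank-one raising operator forces `𝔊 = End(W)` when `dim P = 2 < 3 ≤ dim Q`
# (Ribet 1983 Thm. 3, Lie step — the «double Levi» route, part IV: the small side of dimension two)

Family `hodge`, layer `Literature/AlgebraicGeometry/Motives` (pure linear algebra over `ℂ`; no geometry). Research
context: cell `pub-hodge-ring2` (HONEST FRAMING: research route conditional on HC_CM; not a corollary; Q11.4-sentence-2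
already refuted in dim ≥ 3), Literature lane gen 85, programme R72. UNCONDITIONAL; theorems only, no definition, no
named fact (D-0026), no `sorry`. Sequel of `HodgeThetaSubalgebraUnitaryRankOneRaise` (R70, which needs `dim P ≥ 3` and
`dim Q ≥ 3`).

THE THEOREM (`UnitaryRankOneRaise.eq_top_of_rankOne_raise_two`). In the unitary setting (`𝔊 ⊆ End(W)` bracket-closed,
irreducible, `Θ ∈ 𝔊` an involution with eigenspaces `P`, `Q`, Hermitian data, `𝔊` adjoint-closed) with `dim P = 2` and
`dim Q = b ≥ 3`: a raising operator `B₁ ∈ 𝔊` of RANK ONE forces `𝔊 = End(W)`. (The mirror `dim P ≥ 3`, `dim Q = 2` is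
`eq_top_of_rankOne_raise_two'`.)

WHY A SEPARATE ARGUMENT. For `dim P = a = 2` the smaller Levi type of `ι = Θ − 2D₁` is `(1 | 1)`, which is NOT an
abstract core (`𝔰𝔩₂ ⊊ 𝔤𝔩₂` is irreducible, graded, adjoint-closed), and `UnitaryAdStable` needs `dim ≥ 3`; so the R70 proof
(both Levi algebras full, both kernel ideals `⊇ 𝔰𝔩`) does not apply.

PROOF. As in R70, the Levi algebra on `U⁻ = B₁(W) ⊕ (Q ∩ ker B₁)` (type `(1 | b − 1)`) is full, and Goursat
(`dim I⁻ ≥ b² − 4 ≥ 2`) with `ad`-stability gives `𝔰𝔩(U⁻) ⊆ I⁻` (`UnitaryRankOneRaise.traceless_sub_of_two_le`). If `I⁻`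
has an element of non-zero trace, it contains a rank-one idempotent and `UnitaryTwoOdd.eq_top_of_rankOne` concludes.
Otherwise EVERY element of `I⁻` is traceless, and we derive a contradiction on the two-dimensional side
`U⁺ = ℂe ⊕ ℂc` (`e ∈ P ∩ ker C₁`, `c ∈ C₁(P)`): by `UnitaryLeviFull.exists_raise_commute_apply_ne_zero` some raising
`R ∈ 𝔊` commuting with `ι` has `Rc = e ≠ 0`; its adjoint `R†` commutes with `ι`, `R†e = t'c` with `t' ≠ 0`
(`s(e,e) = s(c, R†e)`), so `H = [R, R†] ∈ 𝔊` acts on `U⁺` as `t'·Θ`. But `H|_{U⁻} = [R|_{U⁻}, R†|_{U⁻}]` is traceless,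
hence in `I⁻`: some `Z' ∈ 𝔊` agrees with `H` on `U⁻` and kills `U⁺`. Then `Θ − t'⁻¹(H − Z') ∈ 𝔊` kills `U⁺` and agrees
with `Θ` on `U⁻`, so `Θ|_{U⁻} ∈ I⁻` — of trace `2 − b ≠ 0`, a contradiction.

## References
* [Ribet1983] K. A. Ribet, *Hodge classes on certain types of abelian varieties*, Amer. J. Math. 105 (1983), Thm. 3
  (= [Gordon1997, Thm. 6.3 (3)], pp. 18–19).
* [Deligne1982HodgeCycles] P. Deligne, *Hodge cycles on abelian varieties*, LNM 900 (1982), I §3 Prop. 3.4, 3.6.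
* [GoodmanWallachGTM255] R. Goodman, N. R. Wallach, GTM 255 (2009), §4.1.1.
* [Humphreys1972] J. E. Humphreys, *Introduction to Lie Algebras and Representation Theory*, §19.1, §4.1.
* [HoffmanKunze1971LinearAlgebra] K. Hoffman, R. Kunze, *Linear Algebra* (1971), §6.7, §3.5–3.6.
-/

noncomputable section

open Module

namespace Literature.AlgebraicGeometry.Motives

namespace HodgeStructure

universe u

variable {W : Type u} [AddCommGroup W] [Module ℂ W]

/-- **A rank-one raising operator forces `𝔊 = End(W)` when `dim P = 2`, `dim Q ≥ 3`.** See the module docstring for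
the statement and the proof. [cite: Ribet1983, Thm. 3] [cite: Gordon1997, Thm. 6.3 (3), pp. 18–19]
[cite: Deligne1982HodgeCycles, I §3 Prop. 3.4, 3.6] [cite: Humphreys1972, §19.1] [cite: GoodmanWallachGTM255, §4.1.1] -/
theorem UnitaryRankOneRaise.eq_top_of_rankOne_raise_two [FiniteDimensional ℂ W] {𝔊 : Submodule ℂ (Module.End ℂ W)}
    (hbr : ∀ Y ∈ 𝔊, ∀ Z ∈ 𝔊, Y * Z - Z * Y ∈ 𝔊)
    (hirr : ∀ U : Submodule ℂ W, (∀ A ∈ 𝔊, ∀ u ∈ U, A u ∈ U) → U = ⊥ ∨ U = ⊤)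
    {Θ : Module.End ℂ W} (hΘ : Θ ∈ 𝔊) (hΘΘ : Θ * Θ = 1)
    {P Q : Submodule ℂ W} (hP : ∀ x, x ∈ P ↔ Θ x = x) (hQ : ∀ x, x ∈ Q ↔ Θ x = -x)
    {s : W → W → ℂ} (hadd : ∀ x y z, s (x + y) z = s x z + s y z) (hsymm : ∀ x y, s y x = starRingEnd ℂ (s x y))
    (hPQ : ∀ p ∈ P, ∀ q ∈ Q, s p q = 0) (hdefP : ∀ p ∈ P, s p p = 0 → p = 0) (hdefQ : ∀ q ∈ Q, s q q = 0 → q = 0)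
    (hadj : ∀ X ∈ 𝔊, ∃ Y ∈ 𝔊, ∀ x y, s (X x) y = s x (Y y))
    {B₁ : Module.End ℂ W} (hB₁ : B₁ ∈ 𝔊) (hΘB₁ : Θ * B₁ = B₁) (hB₁Θ : B₁ * Θ = -B₁)
    (hr1 : Module.finrank ℂ (LinearMap.range B₁) = 1)
    (hP2 : Module.finrank ℂ P = 2) (hQ3 : 3 ≤ Module.finrank ℂ Q) :
    𝔊 = ⊤ := by
  classical
  obtain ⟨haddr, h0r, h0l, hnegr, hnegl, hsubr, hsubl⟩ := UnitaryTwoOdd.herm_right hadd hsymm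
  have hΘΘv : ∀ v, Θ (Θ v) = v := fun v => by rw [← Module.End.mul_apply, hΘΘ, Module.End.one_apply]
  obtain ⟨C, hC, ι, hιmem, hBC, hΘC, hCΘ, hιι, hιΘ, hιs, hιa, hιd, hιb, hιc, hmemA, hmemD, hmemB, hmemC, hfinP₀, hfinQ₀,
    hfinQU, hrangeP, hmapCQ, hfinUm, hfinUp⟩ :=
    UnitaryLeviKernel.exists_involution hbr hΘ hΘΘ hP hQ hadd hsymm hPQ hdefP hdefQ hadj hB₁ hΘB₁ hB₁Θ
  have hιv : ∀ v, ι (ι v) = v := fun v => by rw [← Module.End.mul_apply, hιι, Module.End.one_apply]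
  have hιΘv : ∀ w, ι (Θ w) = Θ (ι w) := fun w => by rw [← Module.End.mul_apply, hιΘ, Module.End.mul_apply]
  set b := Module.finrank ℂ Q with hbdef
  set Um : Submodule ℂ W := LinearMap.ker (ι + 1) with hUmdef
  set Up : Submodule ℂ W := LinearMap.ker (ι - 1) with hUpdef
  have hUm : ∀ x, x ∈ Um ↔ ι x = -x := fun x => by
    rw [hUmdef, LinearMap.mem_ker, LinearMap.add_apply, Module.End.one_apply, add_eq_zero_iff_eq_neg]
  have hUp : ∀ x, x ∈ Up ↔ ι x = x := fun x => by
    rw [hUpdef, LinearMap.mem_ker, LinearMap.sub_apply, Module.End.one_apply, sub_eq_zero]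
  have hcm : ∀ Z : Module.End ℂ W, Z * ι = ι * Z → ∀ x ∈ Um, Z x ∈ Um := fun Z hZ x hx =>
    (hUm _).2 (by rw [← Module.End.mul_apply, ← hZ, Module.End.mul_apply, (hUm x).1 hx, map_neg])
  have hcp : ∀ Z : Module.End ℂ W, Z * ι = ι * Z → ∀ x ∈ Up, Z x ∈ Up := fun Z hZ x hx =>
    (hUp _).2 (by rw [← Module.End.mul_apply, ← hZ, Module.End.mul_apply, (hUp x).1 hx])
  have hraiseP : ∀ Y : Module.End ℂ W, Y * Θ = -Y → ∀ p, Θ p = p → Y p = 0 := fun Y hYΘ p hp => by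
    have h : Y p = -(Y p) := by
      conv_lhs => rw [← hp]
      rw [← Module.End.mul_apply, hYΘ, LinearMap.neg_apply]
    have h2 : (2 : ℂ) • Y p = 0 := by rw [two_smul]; nth_rewrite 2 [h]; rw [add_neg_cancel]
    exact (smul_eq_zero.1 h2).resolve_left two_ne_zero
  have hlowerQ : ∀ Y : Module.End ℂ W, Y * Θ = Y → ∀ q, Θ q = -q → Y q = 0 := fun Y hYΘ q hq => by
    have h : Y q = -(Y q) := by
      conv_lhs => rw [← hYΘ, Module.End.mul_apply, hq, map_neg]
    have h2 : (2 : ℂ) • Y q = 0 := by rw [two_smul]; nth_rewrite 2 [h]; rw [add_neg_cancel]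
    exact (smul_eq_zero.1 h2).resolve_left two_ne_zero
  -- STEP 1: the Levi algebra on `U⁻` (type `(1 | b − 1)`) is full
  have hPUle : LinearMap.range B₁ ≤ Um := fun x hx => (hUm x).2 (hιa x hx)
  have hQUle : Q ⊓ LinearMap.ker B₁ ≤ Um := fun d hd => (hUm d).2 (hιd d hd)
  have hPUmem : ∀ x ∈ Um, Θ x = x → x ∈ LinearMap.range B₁ := fun x hx hΘx => hmemA x ((hUm x).1 hx) hΘx
  have hPUΘ : ∀ x ∈ LinearMap.range B₁, Θ x = x := fun x hx => (hP x).1 (hrangeP hx)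
  have hQUmem : ∀ x ∈ Um, Θ x = -x → x ∈ Q ⊓ LinearMap.ker B₁ := fun x hx hΘx => hmemD x ((hUm x).1 hx) hΘx
  have hQUΘ : ∀ x ∈ Q ⊓ LinearMap.ker B₁, Θ x = -x := fun x hx => (hQ x).1 (Submodule.mem_inf.1 hx).1
  have hPUQU : ∀ x ∈ LinearMap.range B₁, ∀ y ∈ Q ⊓ LinearMap.ker B₁, s x y = 0 := fun x hx y hy =>
    hPQ x (hrangeP hx) y (Submodule.mem_inf.1 hy).1
  have hdefPU : ∀ x ∈ LinearMap.range B₁, s x x = 0 → x = 0 := fun x hx h => hdefP x (hrangeP hx) h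
  have hdefQU : ∀ y ∈ Q ⊓ LinearMap.ker B₁, s y y = 0 → y = 0 := fun y hy h =>
    hdefQ y (Submodule.mem_inf.1 hy).1 h
  have hfullm := UnitaryThreeCoprime.levi_instance hbr hirr hΘΘ hP hQ hadd hsymm hPQ hdefP hdefQ hadj hιmem hιι hιs hΘ
    hΘΘ hιΘ hUm hPUle hQUle hPUmem hPUΘ hQUmem hQUΘ hPUQU hdefPU hdefQU
    (fun 𝔩 ι' P' Q' hbr𝔩 hirr𝔩 hι' hι'ι' hP' hQ' hfinP' hfinQ' _ _ _ _ =>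
      UnitaryThreeCoprime.eq_top_of_finrank_eq_one hbr𝔩 hirr𝔩 (Submodule.neg_mem _ hι') ((neg_mul_neg ι' ι').trans hι'ι')
        (P := Q') (Q := P') (fun x => by rw [hQ', LinearMap.neg_apply, neg_eq_iff_eq_neg])
        (fun x => by rw [hP', LinearMap.neg_apply, neg_inj]) (by rw [hfinQ']; omega) (by rw [hfinP', hr1]))
  -- STEP 2: Goursat — the Levi kernel ideal `I⁻` contains `𝔰𝔩(U⁻)`
  obtain ⟨Im, Ip, Lm, Lp, hIm, -, hLm, hLp, hdim⟩ := UnitaryLeviKernel.exists_kernel_levi 𝔊 hιι hUm hUp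
  obtain ⟨-, hLmfull⟩ := UnitaryLeviKernel.finrank_levi hLm
  obtain ⟨hLpdim, -⟩ := UnitaryLeviKernel.finrank_levi hLp
  have hLmdim := hLmfull hfullm
  rw [hfinUm] at hLmdim
  rw [hfinUp, hP2] at hLpdim
  have hadm := UnitaryLeviKernel.kernel_adStable hbr hUp hIm hfullm
  have h3m : 3 ≤ Module.finrank ℂ Um := by rw [hfinUm]; exact hQ3
  have h2m : 2 ≤ Module.finrank ℂ Im := by
    have h9b : 3 * 3 ≤ b * b := Nat.mul_le_mul hQ3 hQ3
    omega
  obtain ⟨htr, N, hN, w, hw⟩ := UnitaryRankOneRaise.traceless_sub_of_two_le Im hadm h2m h3m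
  have hΘm : ∀ x ∈ Um, Θ x ∈ Um := hcm Θ hιΘ.symm
  -- STEP 3 (Case A): an element of `I⁻` of non-zero trace gives a rank-one idempotent in `𝔊`
  by_cases hA : ∃ T ∈ Im, LinearMap.trace ℂ Um T ≠ 0
  · obtain ⟨T, hT, hT0⟩ := hA
    obtain ⟨u, φ, hφu, hmem⟩ := UnitaryAdStable.exists_rankOne_idempotent Im hadm hN hw h3m hT hT0
    obtain ⟨Z₁, hZ₁, hZ₁val, hZ₁0⟩ := (hIm _).1 hmem
    have hmm : ∀ y, ((2 : ℂ)⁻¹ • (1 - ι)) y ∈ Um := fun y => (hUm _).2 (by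
      simp only [LinearMap.smul_apply, LinearMap.sub_apply, Module.End.one_apply, map_smul, map_sub, hιv]
      module)
    set πm : W →ₗ[ℂ] Um := LinearMap.codRestrict Um ((2 : ℂ)⁻¹ • (1 - ι)) hmm with hπmdef
    have hπmval : ∀ y, (πm y : W) = (2 : ℂ)⁻¹ • (y - ι y) := fun y => by
      rw [hπmdef, LinearMap.codRestrict_apply, LinearMap.smul_apply, LinearMap.sub_apply, Module.End.one_apply]
    have hπm_id : ∀ x : Um, πm x = x := fun x => Subtype.ext (by rw [hπmval, (hUm x).1 x.2]; module)
    have hp_mem : ∀ y, (2 : ℂ)⁻¹ • (y + ι y) ∈ Up := fun y =>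
      (hUp _).2 (by rw [map_smul, map_add, hιv, add_comm])
    set φ' : Module.Dual ℂ W := φ ∘ₗ πm with hφ'def
    have hZ₁eq : Z₁ = φ'.smulRight (u : W) := by
      refine LinearMap.ext fun y => ?_
      have hy : y = (πm y : W) + (2 : ℂ)⁻¹ • (y + ι y) := by rw [hπmval]; module
      rw [LinearMap.smulRight_apply, hφ'def, LinearMap.comp_apply]
      conv_lhs => rw [hy, map_add, hZ₁0 _ (hp_mem y), add_zero, ← hZ₁val (πm y)]
      rw [LinearMap.smulRight_apply, Submodule.coe_smul]
    have hφ'u : φ' (u : W) = 1 := by rw [hφ'def, LinearMap.comp_apply, hπm_id, hφu]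
    exact UnitaryTwoOdd.eq_top_of_rankOne hbr hirr hφ'u (hZ₁eq ▸ hZ₁)
  -- STEP 4 (Case B): every element of `I⁻` is traceless — contradiction on the two-dimensional side `U⁺`
  exfalso
  push Not at hA
  -- dimensions on `U⁺`: `P ∩ ker C` and `C(P)` are lines
  have hfinP₀1 : Module.finrank ℂ ↥(P ⊓ LinearMap.ker C) = 1 := by rw [hr1, hP2] at hfinP₀; omega
  have hfinQU1 : Module.finrank ℂ ↥(P.map C) = 1 := by rw [hfinQU, hr1]
  -- a raising `R` commuting with `ι` with `R c ≠ 0`, `c ∈ C(P)`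
  have hp : ∃ p, p ≠ 0 ∧ ι p = p ∧ Θ p = p := by
    obtain ⟨⟨p, hp⟩, hp0⟩ := Module.finrank_pos_iff_exists_ne_zero.1
      (show 0 < Module.finrank ℂ ↥(P ⊓ LinearMap.ker C) by omega)
    exact ⟨p, fun h => hp0 (Subtype.ext h), hιb p hp, (hP p).1 (Submodule.mem_inf.1 hp).1⟩
  have hq : ∃ q, q ≠ 0 ∧ ι q = q ∧ Θ q = -q := by
    obtain ⟨⟨q, hq⟩, hq0⟩ := Module.finrank_pos_iff_exists_ne_zero.1
      (show 0 < Module.finrank ℂ ↥(P.map C) by omega)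
    exact ⟨q, fun h => hq0 (Subtype.ext h), hιc q hq, (hQ q).1 (hmapCQ hq)⟩
  obtain ⟨R, hR, hΘR, hRΘ, hRc, c, hιc', hΘc, hRc0⟩ :=
    UnitaryLeviFull.exists_raise_commute_apply_ne_zero hbr hirr hΘ hΘΘ hQ hιmem hιι hιΘ hUm hUp hp hq
  have hΘe : Θ (R c) = R c := by rw [← Module.End.mul_apply, hΘR]
  have hιe : ι (R c) = R c := by rw [← Module.End.mul_apply, ← hRc, Module.End.mul_apply, hιc']
  have heP : R c ∈ P := (hP _).2 hΘe
  have hemem : R c ∈ P ⊓ LinearMap.ker C := hmemB _ hιe hΘe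
  have hcmem : c ∈ P.map C := hmemC c hιc' hΘc
  -- the adjoint `R†`
  obtain ⟨Rd, hRd, hRRd⟩ := hadj R hR
  obtain ⟨hΘRd, hRdΘ⟩ := UnitaryTwoOdd.lower_of_adjoint hadd hsymm hΘΘ hP hQ hPQ hdefP hdefQ hΘR hRΘ hRRd
  have hRdc : Rd * ι = ι * Rd := by
    refine LinearMap.ext fun y => ?_
    rw [← sub_eq_zero, ← LinearMap.sub_apply]
    refine UnitaryTwoOdd.eq_zero_of_forall_left hadd hsymm hΘΘ hP hQ hPQ hdefP hdefQ fun x => ?_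
    rw [LinearMap.sub_apply, hsubr, Module.End.mul_apply, Module.End.mul_apply, ← hRRd, ← hιs, ← hιs, ← hRRd,
      ← Module.End.mul_apply, ← Module.End.mul_apply, hRc, sub_self]
  have hRde0 : Rd (R c) ≠ 0 := by
    intro h0
    have h1 : s (R c) (R c) = 0 := by rw [hRRd c (R c), h0, h0r]
    exact hRc0 (hdefP _ heP h1)
  have hΘRde : Θ (Rd (R c)) = -(Rd (R c)) := by rw [← Module.End.mul_apply, hΘRd, LinearMap.neg_apply]
  have hιRde : ι (Rd (R c)) = Rd (R c) := by rw [← Module.End.mul_apply, ← hRdc, Module.End.mul_apply, hιe]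
  have hRdemem : Rd (R c) ∈ P.map C := hmemC _ hιRde hΘRde
  have hc0 : c ≠ 0 := fun h => hRc0 (by rw [h, map_zero])
  obtain ⟨t', ht'⟩ := Submodule.mem_span_singleton.1
    (UnitaryTwoOdd.mem_span_of_finrank_le_one hfinQU1.le hcmem hRdemem hc0)
  have ht'0 : t' ≠ 0 := fun h => hRde0 (by rw [← ht', h, zero_smul])
  -- `H = [R, R†]` acts on `U⁺ = ℂe ⊕ ℂc` as `t'·Θ`
  set H : Module.End ℂ W := R * Rd - Rd * R with hHdef
  have hHmem : H ∈ 𝔊 := hbr R hR Rd hRd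
  have hHc : H * ι = ι * H := by
    rw [hHdef, sub_mul, mul_sub, mul_assoc, hRdc, ← mul_assoc, hRc, mul_assoc, mul_assoc, hRc, ← mul_assoc Rd, hRdc,
      mul_assoc]
  have hHe : H (R c) = t' • R c := by
    rw [hHdef, LinearMap.sub_apply, Module.End.mul_apply, Module.End.mul_apply, hraiseP R hRΘ _ hΘe, map_zero,
      sub_zero, ← ht', map_smul]
  have hHcval : H c = -(t' • c) := by
    rw [hHdef, LinearMap.sub_apply, Module.End.mul_apply, Module.End.mul_apply, hlowerQ Rd hRdΘ c hΘc, map_zero,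
      zero_sub, ht']
  have he0 : R c ≠ 0 := hRc0
  have hUpdec : ∀ x ∈ Up, ∃ α β : ℂ, x = α • R c + β • c := by
    intro x hx
    have hιx := (hUp x).1 hx
    have h1 : (2 : ℂ)⁻¹ • (x + Θ x) ∈ P ⊓ LinearMap.ker C := hmemB _
      (by rw [map_smul, map_add, hιΘv, hιx]) (by rw [map_smul, map_add, hΘΘv, add_comm])
    have h2 : (2 : ℂ)⁻¹ • (x - Θ x) ∈ P.map C := hmemC _
      (by rw [map_smul, map_sub, hιΘv, hιx]) (by rw [map_smul, map_sub, hΘΘv, ← smul_neg, neg_sub])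
    obtain ⟨α, hα⟩ := Submodule.mem_span_singleton.1
      (UnitaryTwoOdd.mem_span_of_finrank_le_one hfinP₀1.le hemem h1 he0)
    obtain ⟨β, hβ⟩ := Submodule.mem_span_singleton.1
      (UnitaryTwoOdd.mem_span_of_finrank_le_one hfinQU1.le hcmem h2 hc0)
    refine ⟨α, β, ?_⟩
    rw [hα, hβ]; module
  have hHΘ : ∀ x ∈ Up, H x = t' • Θ x := by
    intro x hx
    obtain ⟨α, β, rfl⟩ := hUpdec x hx
    simp only [map_add, map_smul, hHe, hHcval, hΘe, hΘc]
    module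
  -- `H|_{U⁻}` is traceless, hence in `I⁻`: `Z'` agrees with `H` on `U⁻` and kills `U⁺`
  have hHm : ∀ x ∈ Um, H x ∈ Um := hcm H hHc
  have hRm : ∀ x ∈ Um, R x ∈ Um := hcm R hRc
  have hRdm : ∀ x ∈ Um, Rd x ∈ Um := hcm Rd hRdc
  have hHres : H.restrict hHm = R.restrict hRm * Rd.restrict hRdm - Rd.restrict hRdm * R.restrict hRm :=
    LinearMap.ext fun x => Subtype.ext (by
      simp only [LinearMap.restrict_apply, LinearMap.sub_apply, Module.End.mul_apply, Submodule.coe_sub, hHdef])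
  have hHtr : LinearMap.trace ℂ Um (H.restrict hHm) = 0 := by
    rw [hHres, map_sub, LinearMap.trace_mul_comm, sub_self]
  obtain ⟨Z', hZ', hZ'val, hZ'0⟩ := (hIm _).1 (htr _ hHtr)
  -- `Θ − t'⁻¹ (H − Z')` kills `U⁺` and is `Θ` on `U⁻`: so `Θ|_{U⁻} ∈ I⁻`
  set T₀ : Module.End ℂ W := Θ - t'⁻¹ • (H - Z') with hT₀def
  have hT₀mem : T₀ ∈ 𝔊 :=
    Submodule.sub_mem _ hΘ (Submodule.smul_mem _ _ (Submodule.sub_mem _ hHmem hZ'))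
  have hT₀p : ∀ x ∈ Up, T₀ x = 0 := by
    intro x hx
    rw [hT₀def, LinearMap.sub_apply, LinearMap.smul_apply, LinearMap.sub_apply, hZ'0 x hx, sub_zero, hHΘ x hx,
      smul_smul, inv_mul_cancel₀ ht'0, one_smul, sub_self]
  have hT₀m : ∀ x : Um, Θ x = T₀ x := by
    intro x
    have h := hZ'val x
    rw [LinearMap.restrict_apply] at h
    rw [hT₀def, LinearMap.sub_apply, LinearMap.smul_apply, LinearMap.sub_apply, ← h, sub_self, smul_zero, sub_zero]
  have hΘIm : Θ.restrict hΘm ∈ Im :=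
    (hIm _).2 ⟨T₀, hT₀mem, fun x => by rw [LinearMap.restrict_apply]; exact hT₀m x, hT₀p⟩
  -- its trace is `2 − b ≠ 0`
  set pM : Submodule ℂ Um := (LinearMap.range B₁).comap Um.subtype with hpMdef
  have hpM : ∀ x : Um, x ∈ pM ↔ Θ (x : W) = x := fun x => by
    rw [hpMdef, Submodule.mem_comap, Submodule.subtype_apply]
    exact ⟨fun h => hPUΘ _ h, fun h => hPUmem _ x.2 h⟩
  have hfinpM : Module.finrank ℂ pM = 1 := by
    rw [hpMdef, (Submodule.comapSubtypeEquivOfLe hPUle).finrank_eq, hr1]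
  have htrΘm : LinearMap.trace ℂ Um (Θ.restrict hΘm) = 2 * (Module.finrank ℂ pM : ℂ) - Module.finrank ℂ Um :=
    UnitaryRankOneRaise.trace_restrict_theta hΘΘ hΘm pM hpM
  have h0 := hA _ hΘIm
  rw [htrΘm, hfinpM, hfinUm, Nat.cast_one, mul_one, sub_eq_zero] at h0
  have hb2 : b = 2 := by exact_mod_cast h0.symm
  omega

/-- **Mirror: `dim P ≥ 3`, `dim Q = 2`.** A rank-one raising operator forces `𝔊 = End(W)`: apply
`eq_top_of_rankOne_raise_two` to `−Θ` and the adjoint `C₁` of `B₁` (a rank-one raising operator for `−Θ`).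
[cite: Ribet1983, Thm. 3] [cite: Deligne1982HodgeCycles, I §3 Prop. 3.6] -/
theorem UnitaryRankOneRaise.eq_top_of_rankOne_raise_two' [FiniteDimensional ℂ W] {𝔊 : Submodule ℂ (Module.End ℂ W)}
    (hbr : ∀ Y ∈ 𝔊, ∀ Z ∈ 𝔊, Y * Z - Z * Y ∈ 𝔊)
    (hirr : ∀ U : Submodule ℂ W, (∀ A ∈ 𝔊, ∀ u ∈ U, A u ∈ U) → U = ⊥ ∨ U = ⊤)
    {Θ : Module.End ℂ W} (hΘ : Θ ∈ 𝔊) (hΘΘ : Θ * Θ = 1)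
    {P Q : Submodule ℂ W} (hP : ∀ x, x ∈ P ↔ Θ x = x) (hQ : ∀ x, x ∈ Q ↔ Θ x = -x)
    {s : W → W → ℂ} (hadd : ∀ x y z, s (x + y) z = s x z + s y z) (hsymm : ∀ x y, s y x = starRingEnd ℂ (s x y))
    (hPQ : ∀ p ∈ P, ∀ q ∈ Q, s p q = 0) (hdefP : ∀ p ∈ P, s p p = 0 → p = 0) (hdefQ : ∀ q ∈ Q, s q q = 0 → q = 0)
    (hadj : ∀ X ∈ 𝔊, ∃ Y ∈ 𝔊, ∀ x y, s (X x) y = s x (Y y))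
    {B₁ : Module.End ℂ W} (hB₁ : B₁ ∈ 𝔊) (hΘB₁ : Θ * B₁ = B₁) (hB₁Θ : B₁ * Θ = -B₁)
    (hr1 : Module.finrank ℂ (LinearMap.range B₁) = 1)
    (hP3 : 3 ≤ Module.finrank ℂ P) (hQ2 : Module.finrank ℂ Q = 2) :
    𝔊 = ⊤ := by
  obtain ⟨C, hC, ι, -, hBC, hΘC, hCΘ, -, -, -, -, -, -, -, -, -, -, -, -, -, hfinQU, -, hmapCQ, -, -⟩ :=
    UnitaryLeviKernel.exists_involution hbr hΘ hΘΘ hP hQ hadd hsymm hPQ hdefP hdefQ hadj hB₁ hΘB₁ hB₁Θ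
  have hnΘ : -Θ ∈ 𝔊 := Submodule.neg_mem _ hΘ
  have hnΘΘ : (-Θ) * (-Θ) = 1 := by rw [neg_mul_neg, hΘΘ]
  have hQ' : ∀ x, x ∈ Q ↔ (-Θ) x = x := fun x => by rw [hQ, LinearMap.neg_apply, neg_eq_iff_eq_neg]
  have hP' : ∀ x, x ∈ P ↔ (-Θ) x = -x := fun x => by rw [hP, LinearMap.neg_apply, neg_inj]
  have hQP : ∀ q ∈ Q, ∀ p ∈ P, s q p = 0 := fun q hq p hp => by
    rw [hsymm, hPQ p hp q hq, map_zero]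
  have hΘC' : (-Θ) * C = C := by rw [neg_mul, hΘC, neg_neg]
  have hCΘ' : C * (-Θ) = -C := by rw [mul_neg, hCΘ]
  -- `C` has rank one: `C(W) = C(P)`
  have hlowerQ : ∀ q, Θ q = -q → C q = 0 := fun q hq => by
    have h : C q = -(C q) := by
      conv_lhs => rw [← hCΘ, Module.End.mul_apply, hq, map_neg]
    have h2 : (2 : ℂ) • C q = 0 := by rw [two_smul]; nth_rewrite 2 [h]; rw [add_neg_cancel]
    exact (smul_eq_zero.1 h2).resolve_left two_ne_zero
  have hΘΘv : ∀ v, Θ (Θ v) = v := fun v => by rw [← Module.End.mul_apply, hΘΘ, Module.End.one_apply]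
  have hrangeC : LinearMap.range C = P.map C := by
    apply le_antisymm
    · rintro _ ⟨w, rfl⟩
      have hw : w = (2 : ℂ)⁻¹ • (w + Θ w) + (2 : ℂ)⁻¹ • (w - Θ w) := by module
      have hPw : (2 : ℂ)⁻¹ • (w + Θ w) ∈ P := (hP _).2 (by rw [map_smul, map_add, hΘΘv, add_comm])
      have hQw : Θ ((2 : ℂ)⁻¹ • (w - Θ w)) = -((2 : ℂ)⁻¹ • (w - Θ w)) := by
        rw [map_smul, map_sub, hΘΘv, ← smul_neg, neg_sub]
      rw [hw, map_add, hlowerQ _ hQw, add_zero]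
      exact Submodule.mem_map_of_mem hPw
    · exact LinearMap.map_le_range
  have hrC : Module.finrank ℂ (LinearMap.range C) = 1 := by rw [hrangeC, hfinQU, hr1]
  exact UnitaryRankOneRaise.eq_top_of_rankOne_raise_two hbr hirr hnΘ hnΘΘ hQ' hP' hadd hsymm hQP hdefQ hdefP hadj hC
    hΘC' hCΘ' hrC hQ2 hP3

end HodgeStructure

end Literature.AlgebraicGeometry.Motives
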